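import Literature.MathematicalPhysics.QuantumFieldTheory.Balaban1983to89.B9Ineq344LocalToKIdx
import Literature.MathematicalPhysics.QuantumFieldTheory.Balaban1983to89.B5GpSettingTorus

/-!
# `Balaban1983to89.B9Ineq344TowerChart` — THE IDENTITY CHART `T_η = Site P 0 ≃ Π_μ[0, N_μ)` (`B6GlobalChartV1.boxEquiv`)
# READ ON OPERATORS AND NORMS: Bałaban's scalar torus tower (`B1RG242Torus.tower`, [B5]'s `G′_k`) ↦ lit-balaban-p21's
# fundamental box (`perLapT`, `dT`, `torusSupNorm`, `hqTP`, `supF`, the blocks `blkOf`) — the dictionary behind the discharge of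
# row 11 of the N06 knit (`B9Ineq344LocalToKIdx.LocalSecondOrderKIdx`) by the ONE-LEVEL TORUS OPERATOR

T. Bałaban, *Propagators and renormalization transformations for lattice gauge theories. I*, Commun. Math. Phys. **95** (1984)
17–40 [`Balaban1984PropagatorsI`, "B5"], §1 (1.4)–(1.6) p. 18 (the lattices and the torus), (1.108)–(1.109) p. 35 (the norms),
Prop. 1.2 p. 36; T. Bałaban, *Propagators and renormalization transformations for lattice gauge theories. II*, Commun. Math. Phys.
**96** (1984) 223–250 [`Balaban1984PropagatorsII`], (2.1)–(2.4) p. 224, (2.13)–(2.14) p. 225; T. Bałaban, *Regularity and decay of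
lattice Green's functions*, Commun. Math. Phys. **89** (1983) 571–597 [`Balaban1983RegularityDecay`], p. 572 (*"a torus T_η which
we identify with a rectangular parallelepiped in ηZ^d with periodic conditions"*); T. Bałaban, *(Higgs)₂,₃ quantum fields in a
finite volume. I*, Commun. Math. Phys. **85** (1982) 603–636 [`Balaban1982Higgs1`], (1.4) p. 604, (1.11) p. 605, (2.20) p. 610.

statement-level skeleton of published theorems with citation tags; proofs where landed; nothing here is a claim about the
Yang–Mills mass gap

THE POINT.  Two typed carriers of the SAME torus: the V1 torus `Site P 0 = (Fin (d+1) → ZMod (2L^{m+K}))` (`P = PV d ℓ m K`),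
carrier of Bałaban's scalar tower (`B1RG242Torus`: `shiftMat`, `deriv`, `hOp = −Δ^ε + m²`, `Qks Qk = Q*_jQ_j`, `(tower P a m²).G j`),
and p21's fundamental box `Π_μ[0, N_μ)` (`boxDom (N0 ℓ M_h k P′)`, carrier of `perLapT`, `dT`, `torusSupNorm`, `hqTP`, `supF`,
`blkOf`), identified by `B6GlobalChartV1.boxEquiv hN` under `hN : N0 = 2L^{m+K}`.  This file transports:
* §1 translations: `toBox_shift` (the chart intertwines `x ↦ x + e_μ`), `shiftMat_mul`∕`shiftMat_zero` (p21's translation matrices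
  compose), ★ `reindex_shiftMat` (`S_μ ↦ S_{e_μ}`), `reindex_deriv` (`∂^s_μ ↦ s⁻¹·dT_μ`), `dT_transpose_mul_dT`, ★ `reindex_hOp`
  (`−Δ^s + m² ↦ m² + s⁻²·(−Δ^{per})`), `reindex_mulVec_apply`;
* §2 the averaging: `l1_QksQk_le` (`Σ_x|(Q*_jQ_ju)(x)| ≤ Σ_x|u(x)|`), `l1_reindex_le`;
* §3 distances, blocks and norms: ★ `T_eq_torusSupNorm` (`|x − x′|` of the tower files IS p21's torus sup-distance of the chart
  points), `blk_eq_of_blkOf_eq`∕`inCube_of_blkOf_eq` (a block `B^j(y)` of p21 lies in the cube `Δ̃(y)` of [B5] at level `j`),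
  `supN_comp_le_supF` (`|f∘e| ≤ |f|`), ★ `holN_comp_le_hqTP` (`‖f∘e‖_{ε;L^j} ≤ ‖f‖_{ε;L^k}` for `j ≤ k`: the η-unit Hölder norm at
  scale `L^j` is dominated by print's one at the top scale), `torusSupNorm_le_of_blkOf_eq` (two sites of one block of level `j` are
  at torus distance `≤ L^j − 1`);
* §4 the charted one-level comparison pair of a level `j`: ★ `towerPairGc` (`G^c = ε^{−2}G^ε_j`), `towerPairAc`
  (`A^c = ε²(−Δ^ε + m² + α_jQ*Q)`), `towerPairVc` (`V^c = a_jL^{−2j}Q*Q`), ★ `towerPairAc_eq` (`A^c = −Δ^{per} + V^c` at `m² = 0`),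
  ★ `towerPairGc_mul_towerPairAc` (`G^cA^c = 1`), `towerPairGc_isSymm`, ★ `l1_towerPairVc_le` (`Σ|V^cu| ≤ aL^{−2j}Σ|u|`), and the
  kernel identities ★ `E_comp_eq` (`(∂_μG′_j∂*_ν(f∘e))(x) = (dT_μG^cdT_νᵀf)(e x)`), ★ `E1_comp_eq` (`(G′_j∂*_ν(f∘e))(x) =
  L^{−j}(G^cdT_νᵀf)(e x)`), `dT_transpose_mulVec` (`(dT_κᵀv)(y) = −(dT_κv)(y − e_κ)`).

HONEST SCOPE.  Dictionary∕bookkeeping between two typed carriers of one torus; no estimate of print is asserted; count-neutral;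
N06 NOT discharged; one finite lattice programme — nothing continuum, nothing about the mass gap.  Cell `pub-ymgap` (HUMAN RULING
D-0062), Track A node N06 [B9], N06-ASSIGNMENT v1 row 11 (bundle F3), seat `pub-ymgap-dag-n06-h` (g5), 2026-08-27.
-/

noncomputable section

namespace Literature.MathematicalPhysics.QuantumFieldTheory.Balaban1983to89.B9Ineq344TowerChart

open Finset Matrix
open B4Reflection242 (boxDom mem_boxDom blk)
open B4ContourShift (supNorm abs_le_supNorm)
open B4TorusKernel.MultiPeriod (torusSupNorm circAbs torusSupNorm_le_supNorm torusSupNorm_nonneg)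
open B6MultiLevelBoxOperator (N0)
open B6MultiLevelTorusOperator (twrap tshift unitVec perLapT tshift_val tshift_tshift tshift_zero shiftMat_neg one_le_of_mem)
open B6Prop22DerivMultiLevelTorus (dT dT_mulVec)
open B6Geom246MultiLevelBox (bset blkOf blkOf_eq_iff_blk lev_eq_of_blkOf_eq scale_bounds)
open B6HolderTermMultiLevelBox (supNorm_le_of_blkOf_eq)
open B6GlobalChartV1 (PV toBox boxEquiv toBox_apply boxEquiv_apply val_boxEquiv_symm)
open B6KLevelCensusIndexV1 (KIdx)
open B6Prop22KLevelTorusCensus (KTIdx)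
open B6Prop22KLevelTorusCensusEta (nKT nKT_pos hqTP hqTP_nonneg)
open B1RG242Torus (hOp Qks Qk tower H α deriv_mulVec)
open B5Ineq137Torus (T toT Nv Nv_pos distX distX_nonneg supN holN holN_nonneg supN_nonneg le_supN fine T_symm T_nonneg
  eq_of_T_eq_zero)
open B5GpSettingTorus (inCube)
open B5Display135Torus (QksQk_apply QksQk_row_sum)
open Node00 (toKT SiteY BlkY)

variable {d ℓ m K : ℕ} {hd : 1 ≤ d + 1} {hL : Odd (ℓ + 1) ∧ 1 < ℓ + 1} {Mh k : ℕ} {P' : Fin (d + 1) → ℕ} {b₀ b₁ : ℝ}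

/-! ## §1 Translations, shift matrices, the derivative and the Laplacian under the chart -/

section Shift

variable (hN : ∀ μ, N0 ℓ Mh k P' μ = (PV d ℓ m K hd hL).sitesPerDir 0)
include hN

/-- the periods of the fundamental box are `≥ 1`. [cite: Balaban1984PropagatorsII, (2.1) p.224, bookkeeping] -/
theorem one_le_N0 (μ : Fin (d + 1)) : 1 ≤ N0 ℓ Mh k P' μ := by
  rw [hN μ]; exact ((PV d ℓ m K hd hL).one_lt_sitesPerDir 0).le

/-- ★ **THE CHART INTERTWINES THE UNIT TRANSLATIONS**: the label vector of `x + e_μ` (addition in `ZMod (2L^{m+K})`) is the torus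
translate by `e_μ` of the label vector of `x` (reduction modulo the period). [cite: Balaban1983RegularityDecay, p.572 («a torus T_η … with periodic conditions»), dictionary] -/
theorem toBox_shift (x : Site (PV d ℓ m K hd hL) 0) (μ : Fin (d + 1)) :
    toBox hN (Site.shift x μ) = tshift (N0 ℓ Mh k P') (unitVec μ) (toBox hN x) := by
  apply Subtype.ext
  funext i
  rw [tshift_val]
  simp only [toBox_apply, twrap, Pi.add_apply, unitVec, Site.shift, Function.update_apply]
  by_cases hi : i = μ
  · subst hi
    simp only [if_true, Pi.single_eq_same]
    rw [ZMod.val_add, ZMod.val_one, hN i]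
    push_cast
    rfl
  · rw [if_neg hi, Pi.single_eq_of_ne hi, add_zero]
    have h1 : ((x i).val : ℤ) < (N0 ℓ Mh k P' i : ℤ) := by
      rw [hN i]; exact_mod_cast ZMod.val_lt (x i)
    exact (Int.emod_eq_of_lt (by positivity) h1).symm

omit hN in
/-- p21's translation matrices compose: `S_s S_t = S_{s+t}`. [cite: Balaban1983RegularityDecay, p.572 («periodic conditions»), dictionary] -/
theorem shiftMat_mul (N : Fin (d + 1) → ℕ) (s t : Fin (d + 1) → ℤ) :
    B6MultiLevelTorusOperator.shiftMat N s * B6MultiLevelTorusOperator.shiftMat N t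
      = B6MultiLevelTorusOperator.shiftMat N (s + t) := by
  classical
  ext x y
  rw [Matrix.mul_apply]
  simp only [B6MultiLevelTorusOperator.shiftMat]
  rw [Finset.sum_eq_single (tshift N s x)]
  · rw [if_pos rfl, one_mul, tshift_tshift]
  · intro z _ hz
    rw [if_neg (Ne.symm hz.symm), zero_mul]
  · intro h; exact absurd (Finset.mem_univ _) h

omit hN in
/-- `S_0 = 1`. [cite: Balaban1983RegularityDecay, p.572 («periodic conditions»), dictionary] -/
theorem shiftMat_zero (N : Fin (d + 1) → ℕ) : B6MultiLevelTorusOperator.shiftMat N 0 = 1 := by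
  classical
  ext x y
  simp only [B6MultiLevelTorusOperator.shiftMat, tshift_zero, Matrix.one_apply]
  by_cases h : x = y
  · rw [if_pos h.symm, if_pos h]
  · rw [if_neg (Ne.symm h), if_neg h]

omit hN in
/-- `dT_μᵀ·dT_μ = 2 − S_{e_μ} − S_{−e_μ}` (the `μ`-th summand of `−Δ^{per}`). [cite: Balaban1983RegularityDecay, (1.3) p.572, dictionary] -/
theorem dT_transpose_mul_dT (N : Fin (d + 1) → ℕ) (μ : Fin (d + 1)) :
    (dT N μ)ᵀ * dT N μ = (2 : ℝ) • (1 : Matrix ↥(boxDom N) ↥(boxDom N) ℝ)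
      - B6MultiLevelTorusOperator.shiftMat N (unitVec μ) - B6MultiLevelTorusOperator.shiftMat N (-unitVec μ) := by
  unfold dT
  rw [Matrix.transpose_sub, Matrix.transpose_one, ← shiftMat_neg, Matrix.sub_mul, Matrix.mul_sub, Matrix.mul_sub,
    Matrix.one_mul, Matrix.mul_one, Matrix.one_mul, shiftMat_mul, neg_add_cancel, shiftMat_zero, two_smul]
  abel

/-- ★ `S_μ ↦ S_{e_μ}`: the tower's shift matrix read through the chart is p21's translation matrix.
[cite: Balaban1982Higgs1, (1.4) p.604; Balaban1983RegularityDecay, p.572, dictionary] -/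
theorem reindex_shiftMat (μ : Fin (d + 1)) :
    Matrix.reindex (boxEquiv hN) (boxEquiv hN) (B1RG242Torus.shiftMat (PV d ℓ m K hd hL) 0 μ)
      = B6MultiLevelTorusOperator.shiftMat (N0 ℓ Mh k P') (unitVec μ) := by
  ext a b
  rw [Matrix.reindex_apply, Matrix.submatrix_apply]
  simp only [B1RG242Torus.shiftMat, B6MultiLevelTorusOperator.shiftMat]
  have key : b = tshift (N0 ℓ Mh k P') (unitVec μ) a ↔
      (boxEquiv hN).symm b = Site.shift ((boxEquiv hN).symm a) μ := by
    rw [Equiv.symm_apply_eq, boxEquiv_apply, toBox_shift hN, ← boxEquiv_apply, Equiv.apply_symm_apply]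
  by_cases h : b = tshift (N0 ℓ Mh k P') (unitVec μ) a
  · rw [if_pos h, if_pos (key.1 h)]
  · rw [if_neg h, if_neg (fun h' => h (key.2 h'))]

/-- `∂^s_μ ↦ s⁻¹·dT_μ`. [cite: Balaban1982Higgs1, (1.4) p.604, dictionary] -/
theorem reindex_deriv (s : ℝ) (μ : Fin (d + 1)) :
    Matrix.reindex (boxEquiv hN) (boxEquiv hN) (B1RG242Torus.deriv (PV d ℓ m K hd hL) 0 s μ) = s⁻¹ • dT (N0 ℓ Mh k P') μ := by
  unfold B1RG242Torus.deriv dT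
  rw [← Matrix.coe_reindexLinearEquiv ℝ ℝ, map_smul, map_sub]
  simp only [Matrix.coe_reindexLinearEquiv]
  rw [reindex_shiftMat hN, Matrix.reindex_apply, Matrix.submatrix_one_equiv]

/-- ★ `−Δ^s + m² ↦ m²·1 + s⁻²·(−Δ^{per})`: the tower's Laplacian (`hOp = m² + Σ_μ ∂ᵀ_μ∂_μ`) read through the chart is p21's
periodic Laplacian up to the spacing. [cite: Balaban1982Higgs1, (1.11) p.605; Balaban1983RegularityDecay, (1.3) p.572, dictionary] -/
theorem reindex_hOp (s msq : ℝ) :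
    Matrix.reindex (boxEquiv hN) (boxEquiv hN) (hOp (PV d ℓ m K hd hL) 0 s msq)
      = msq • (1 : Matrix _ _ ℝ) + (s⁻¹ * s⁻¹) • perLapT (N0 ℓ Mh k P') := by
  unfold hOp
  rw [← Matrix.coe_reindexLinearEquiv ℝ ℝ, map_add, map_smul, map_sum]
  simp only [Matrix.coe_reindexLinearEquiv]
  rw [Matrix.reindex_apply, Matrix.submatrix_one_equiv]
  congr 1
  unfold perLapT
  rw [Finset.smul_sum]
  refine Finset.sum_congr rfl fun μ _ => ?_
  rw [Matrix.reindex_apply, ← Matrix.submatrix_mul_equiv _ _ _ (boxEquiv hN).symm _, ← Matrix.transpose_submatrix,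
    ← Matrix.reindex_apply, reindex_deriv hN, Matrix.transpose_smul, Matrix.smul_mul, Matrix.mul_smul, smul_smul,
    dT_transpose_mul_dT]

/-- a matrix read through the chart acts on `f` as the original acts on `f ∘ chart` (the two carriers are one torus).
[cite: Balaban1983RegularityDecay, p.572 («a torus T_η which we identify with a rectangular parallelepiped»), dictionary] -/
theorem reindex_mulVec_apply (M : Matrix (Site (PV d ℓ m K hd hL) 0) (Site (PV d ℓ m K hd hL) 0) ℝ)
    (f : ↥(boxDom (N0 ℓ Mh k P')) → ℝ) (x : Site (PV d ℓ m K hd hL) 0) :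
    (Matrix.reindex (boxEquiv hN) (boxEquiv hN) M *ᵥ f) (boxEquiv hN x) = (M *ᵥ (f ∘ boxEquiv hN)) x := by
  rw [Matrix.reindex_apply, Matrix.submatrix_mulVec_equiv, Function.comp_apply, Equiv.symm_apply_apply, Equiv.symm_symm]

end Shift

/-! ## §2 The averaging operator `Q*_jQ_j`: an `ℓ¹`-contraction -/

section Averaging

/-- `Q*_jQ_j` has nonnegative entries with column sums one (`j ≤ m + K`): it is an `ℓ¹`-contraction,
`Σ_x |(Q*_jQ_ju)(x)| ≤ Σ_x |u(x)|`. [cite: Balaban1982Higgs1, (2.11) p.609 (the block average), bookkeeping] -/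
theorem l1_QksQk_le (P : Params) {j : ℕ} (hj : j ≤ P.m + P.K) (u : Site P 0 → ℝ) :
    ∑ x, |((Qks P j * Qk P j) *ᵥ u) x| ≤ ∑ x, |u x| := by
  have hw : 0 ≤ B4Ineq115Torus.wj P j := (B4Ineq115Torus.wj_pos P j).le
  have hnn : ∀ x x'', 0 ≤ (Qks P j * Qk P j) x x'' := fun x x'' => by
    rw [QksQk_apply]; split_ifs <;> [exact hw; exact le_rfl]
  have hsymm : ∀ x x'', (Qks P j * Qk P j) x x'' = (Qks P j * Qk P j) x'' x := fun x x'' => by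
    rw [QksQk_apply, QksQk_apply]
    by_cases h : Site.proj j (B1RG242Torus.lvl P j) x'' = Site.proj j (B1RG242Torus.lvl P j) x
    · rw [if_pos h, if_pos h.symm]
    · rw [if_neg h, if_neg (fun h' => h h'.symm)]
  calc ∑ x, |((Qks P j * Qk P j) *ᵥ u) x|
      ≤ ∑ x, ∑ x'', (Qks P j * Qk P j) x x'' * |u x''| := by
        refine Finset.sum_le_sum fun x _ => ?_
        rw [Matrix.mulVec, dotProduct]
        refine (Finset.abs_sum_le_sum_abs _ _).trans (Finset.sum_le_sum fun x'' _ => ?_)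
        rw [abs_mul, abs_of_nonneg (hnn x x'')]
    _ = ∑ x'', |u x''| * ∑ x, (Qks P j * Qk P j) x'' x := by
        rw [Finset.sum_comm]
        refine Finset.sum_congr rfl fun x'' _ => ?_
        rw [Finset.mul_sum]
        refine Finset.sum_congr rfl fun x _ => ?_
        rw [hsymm x x'', mul_comm]
    _ = ∑ x'', |u x''| := by
        refine Finset.sum_congr rfl fun x'' _ => ?_
        rw [QksQk_row_sum hj, mul_one]

/-- sums are invariant under the chart: `Σ_a |(M^e u)(a)| = Σ_x |(M(u∘e))(x)|` and `Σ_a |u a| = Σ_x |u(e x)|`, so an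
`ℓ¹`-bound of `M` is an `ℓ¹`-bound of the charted matrix. [cite: Balaban1983RegularityDecay, p.572 («a torus T_η which we identify with a rectangular parallelepiped»), dictionary] -/
theorem l1_reindex_le (hN : ∀ μ, N0 ℓ Mh k P' μ = (PV d ℓ m K hd hL).sitesPerDir 0)
    (M : Matrix (Site (PV d ℓ m K hd hL) 0) (Site (PV d ℓ m K hd hL) 0) ℝ) {c : ℝ}
    (hM : ∀ v : Site (PV d ℓ m K hd hL) 0 → ℝ, ∑ x, |(M *ᵥ v) x| ≤ c * ∑ x, |v x|)
    (u : ↥(boxDom (N0 ℓ Mh k P')) → ℝ) :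
    ∑ a, |(Matrix.reindex (boxEquiv hN) (boxEquiv hN) M *ᵥ u) a| ≤ c * ∑ a, |u a| := by
  have h1 : ∑ a, |(Matrix.reindex (boxEquiv hN) (boxEquiv hN) M *ᵥ u) a|
      = ∑ x, |(M *ᵥ (u ∘ boxEquiv hN)) x| := by
    rw [← Equiv.sum_comp (boxEquiv hN)]
    refine Finset.sum_congr rfl fun x _ => ?_
    rw [reindex_mulVec_apply hN]
  have h2 : ∑ a, |u a| = ∑ x, |(u ∘ boxEquiv hN) x| := by
    rw [← Equiv.sum_comp (boxEquiv hN)]; rfl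
  rw [h1, h2]
  exact hM _

end Averaging

/-! ## §3 Distances, blocks and norms under the chart -/

section Norms

variable (hN : ∀ μ, N0 ℓ Mh k P' μ = (PV d ℓ m K hd hL).sitesPerDir 0)
include hN

/-- ★ **THE TOWER FILES' `|x − x′|` IS p21's TORUS SUP-DISTANCE OF THE CHART POINTS**: `T P 0 x x′ = |e x − e x′|_T`.
[cite: Balaban1984PropagatorsI, p.17 l.30 and p.36 (torus distances); Balaban1984PropagatorsII, (2.46) p.231, dictionary] -/
theorem T_eq_torusSupNorm (x x' : Site (PV d ℓ m K hd hL) 0) :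
    T (PV d ℓ m K hd hL) 0 x x' = torusSupNorm (N0 ℓ Mh k P') ((toBox hN x).1 - (toBox hN x').1) := by
  have hNv : ∀ i, 1 ≤ Nv (PV d ℓ m K hd hL) 0 i := Nv_pos _ 0
  have hper : ∀ i, Nv (PV d ℓ m K hd hL) 0 i = N0 ℓ Mh k P' i := fun i => (hN i).symm
  have hc : ∀ i, ((B4Sect5Torus.ccoord (Nv (PV d ℓ m K hd hL) 0) (toT x) (toT x') i : ℕ) : ℝ)
      = ((circAbs (N0 ℓ Mh k P' i) (((toBox hN x).1 - (toBox hN x').1) i) : ℤ) : ℝ) := by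
    intro i
    rw [← hper i]
    have h := B4Sect5Torus.ccoord_cast hNv (toT x) (toT x') i
    have h' : ((B4Sect5Torus.ccoord (Nv (PV d ℓ m K hd hL) 0) (toT x) (toT x') i : ℕ) : ℝ)
        = ((circAbs (Nv (PV d ℓ m K hd hL) 0 i) ((((toT x) i).val : ℤ) - (((toT x') i).val : ℤ)) : ℤ) : ℝ) := by
      rw [← h, Int.cast_natCast]
    rw [h']
    rfl
  apply le_antisymm
  · obtain ⟨i, -, hi⟩ := Finset.exists_mem_eq_sup (Finset.univ : Finset (Fin (d + 1))) Finset.univ_nonempty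
      (B4Sect5Torus.ccoord (Nv (PV d ℓ m K hd hL) 0) (toT x) (toT x'))
    unfold T B4Sect5Torus.tdist
    rw [hi, hc i]
    exact Finset.le_sup' (fun j => ((circAbs (N0 ℓ Mh k P' j) (((toBox hN x).1 - (toBox hN x').1) j) : ℤ) : ℝ))
      (Finset.mem_univ i)
  · unfold torusSupNorm
    refine Finset.sup'_le _ _ fun i _ => ?_
    rw [← hc i]
    unfold T B4Sect5Torus.tdist
    exact_mod_cast Finset.le_sup (f := B4Sect5Torus.ccoord (Nv (PV d ℓ m K hd hL) 0) (toT x) (toT x')) (Finset.mem_univ i)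

/-- sites of the fundamental box with the same p21 block label at level `j ≤ m + K` have the same [B5] block `blk P j`.
[cite: Balaban1984PropagatorsI, (1.6) p.18 (blocks B(y)); Balaban1984PropagatorsII, (2.1) p.224, dictionary] -/
theorem blk_eq_of_blk_toBox_eq {j : ℕ} (hj : j ≤ m + K) {x x' : Site (PV d ℓ m K hd hL) 0}
    (h : blk ((ℓ + 1) ^ j) (toBox hN x).1 = blk ((ℓ + 1) ^ j) (toBox hN x').1) :
    B5Ineq137Torus.blk (PV d ℓ m K hd hL) j x = B5Ineq137Torus.blk (PV d ℓ m K hd hL) j x' := by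
  funext μ
  apply ZMod.val_injective
  rw [B5Ineq137Torus.blk_val _ hj, B5Ineq137Torus.blk_val _ hj]
  have hμ := congrFun h μ
  change ((x μ).val : ℤ) / ((((ℓ + 1) ^ j : ℕ)) : ℤ) = ((x' μ).val : ℤ) / ((((ℓ + 1) ^ j : ℕ)) : ℤ) at hμ
  rw [← Int.natCast_div, ← Int.natCast_div] at hμ
  exact_mod_cast hμ

omit hN in
/-- ★ **A BLOCK OF p21 LIES IN ONE CUBE `Δ̃(y′)` OF [B5] AT ITS LEVEL**: if the chart points of `x` and `x₀` have the same p21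
block `s` of a torus family `D` (an index `i : KIdx`), then `x ∈ Δ̃(y′)` for `y′ = blk j x₀`, `j = level of s`.
[cite: Balaban1984PropagatorsI, p.35 («x ∈ Δ̃(y), supp J ⊂ Δ̃(y′)»); Balaban1984PropagatorsII, (2.45) p.231, dictionary] -/
theorem inCube_of_blkOf_eq (i : KIdx d ℓ hd hL b₀ b₁) {s : BlkY i} {x x₀ : Site (PV d ℓ i.m i.K hd hL) 0}
    (hx : blkOf i.D.toDomains (boxEquiv i.hN x) = s) (hx₀ : blkOf i.D.toDomains (boxEquiv i.hN x₀) = s) :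
    inCube (PV d ℓ i.m i.K hd hL) s.1.1 x (B5Ineq137Torus.blk (PV d ℓ i.m i.K hd hL) s.1.1 x₀) := by
  have hj : s.1.1 ≤ i.m + i.K := (scale_bounds i.D.toDomains s).2.trans i.hk
  have h1 := (blkOf_eq_iff_blk i.D.toDomains).1 hx
  have h2 := (blkOf_eq_iff_blk i.D.toDomains).1 hx₀
  rw [boxEquiv_apply] at h1 h2
  rw [← blk_eq_of_blk_toBox_eq i.hN hj (h1.trans h2.symm)]
  unfold inCube
  have h := B5Ineq137Torus.T_blk_le (PV d ℓ i.m i.K hd hL) hj x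
  linarith

omit hN

/-- `|f ∘ e| ≤ |f|` (the sup norm of the tower files against p21's `supF`). [cite: Balaban1984PropagatorsI, (1.108) p.35, dictionary] -/
theorem supN_comp_le_supF (i : KIdx d ℓ hd hL b₀ b₁) (f : SiteY i → ℝ) :
    supN (PV d ℓ i.m i.K hd hL) (f ∘ boxEquiv i.hN) ≤ (toKT i).supF f := by
  refine Finset.sup'_le _ _ fun x _ => ?_
  exact le_ciSup (f := fun y : SiteY i => |f y|) (Set.finite_range _).bddAbove (boxEquiv i.hN x)

/-- ★ **THE η-UNIT HÖLDER NORM OF THE TOWER FILES AT SCALE `L^j` IS DOMINATED BY PRINT'S AT THE TOP SCALE `L^k`** (`j ≤ k`):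
`holN P j ε (f ∘ e) ≤ hqTP (toKT i) ε f` for `0 ≤ ε` — over pairs at torus distance `≤ L^j` the quotient with denominator
`(|x−x′|_T∕L^j)^ε` is at most the one with `(|x−x′|_T∕L^k)^ε`. [cite: Balaban1984PropagatorsI, (1.109) p.35; Balaban1984PropagatorsII, Prop. 2.2 (2.67) p.234 («‖λ‖_ε»), dictionary] -/
theorem holN_comp_le_hqTP (i : KIdx d ℓ hd hL b₀ b₁) {j : ℕ} (hjk : j ≤ i.k) {ε : ℝ} (hε : 0 ≤ ε) (f : SiteY i → ℝ) :
    holN (PV d ℓ i.m i.K hd hL) j ε (f ∘ boxEquiv i.hN) ≤ hqTP (toKT i) ε f := by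
  classical
  set P := PV d ℓ i.m i.K hd hL
  have hq0 : 0 ≤ hqTP (toKT i) ε f := hqTP_nonneg (toKT i) ε f
  refine Finset.sup'_le _ _ fun p _ => ?_
  rcases p with ⟨x, x'⟩
  dsimp only
  split_ifs with h1
  swap
  · exact hq0
  by_cases hxx : x = x'
  · subst hxx
    simp only [Function.comp_apply, sub_self, abs_zero, zero_div]
    exact hq0
  -- a genuine pair: compare the two quotients
  have hLpos : (0 : ℝ) < (ℓ : ℝ) + 1 := by positivity
  have hT0 : 0 < T P 0 x x' := by
    rcases eq_or_lt_of_le (T_nonneg P 0 x x') with h0 | h0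
    · exact absurd (eq_of_T_eq_zero P h0.symm) hxx
    · exact h0
  have hTe : T P 0 x x' = torusSupNorm (N0 ℓ i.Mh i.k i.P') ((toBox i.hN x').1 - (toBox i.hN x).1) := by
    rw [T_symm, T_eq_torusSupNorm i.hN]
  set a : SiteY i := boxEquiv i.hN x with ha
  set a' : SiteY i := boxEquiv i.hN x' with ha'
  have hne : a ≠ a' := fun h => hxx ((boxEquiv i.hN).injective h)
  -- the term of `hqTP` for the pair `(e x, e x′)`
  have hterm : |f a' - f a| / (torusSupNorm (toKT i).NB (a'.1 - a.1) / (nKT (toKT i))) ^ ε ≤ hqTP (toKT i) ε f := by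
    have h := le_ciSup (f := fun p : SiteY i × SiteY i => if p.1 ≠ p.2 then
        |f p.2 - f p.1| / (torusSupNorm (toKT i).NB (p.2.1 - p.1.1) / (nKT (toKT i))) ^ ε else 0)
      (Set.finite_range _).bddAbove (a, a')
    dsimp only at h
    rw [if_pos hne] at h
    exact h
  refine le_trans ?_ hterm
  have hτ : distX P j x x' = T P 0 x x' / ((ℓ : ℝ) + 1) ^ j := by
    show ((((ℓ + 1 : ℕ) : ℝ)) ^ j)⁻¹ * T P 0 x x' = _
    push_cast
    rw [div_eq_inv_mul]
  show |f a' - f a| / distX P j x x' ^ ε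
      ≤ |f a' - f a| / (torusSupNorm (N0 ℓ i.Mh i.k i.P') ((toBox i.hN x').1 - (toBox i.hN x).1)
        / (((ℓ + 1) ^ i.k : ℕ) : ℝ)) ^ ε
  rw [← hTe, hτ]
  push_cast
  -- compare denominators: `(τ/L^k)^ε ≤ (τ/L^j)^ε`
  have hden_pos : 0 < (T P 0 x x' / ((ℓ : ℝ) + 1) ^ i.k) ^ ε :=
    Real.rpow_pos_of_pos (div_pos hT0 (pow_pos hLpos _)) ε
  have hden_le : (T P 0 x x' / ((ℓ : ℝ) + 1) ^ i.k) ^ ε ≤ (T P 0 x x' / ((ℓ : ℝ) + 1) ^ j) ^ ε := by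
    refine Real.rpow_le_rpow (div_nonneg hT0.le (pow_pos hLpos _).le) ?_ hε
    exact div_le_div_of_nonneg_left hT0.le (pow_pos hLpos _) (pow_le_pow_right₀ (by linarith) hjk)
  exact div_le_div_of_nonneg_left (abs_nonneg _) hden_pos hden_le

/-- two sites of one p21 block of level `j` are at torus sup-distance `≤ L^j − 1`. [cite: Balaban1984PropagatorsII, (2.1) p.224, (2.46) p.231, dictionary] -/
theorem torusSupNorm_le_of_blkOf_eq (i : KIdx d ℓ hd hL b₀ b₁) {x x' : SiteY i}
    (h : blkOf i.D.toDomains x' = blkOf i.D.toDomains x) :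
    torusSupNorm (toKT i).NB (x'.1 - x.1) ≤ ((ℓ : ℝ) + 1) ^ (blkOf i.D.toDomains x).1.1 - 1 := by
  have h1 := supNorm_le_of_blkOf_eq (D := i.D.toDomains) h
  have h2 := torusSupNorm_le_supNorm (fun μ => one_le_of_mem x.2 μ) (x'.1 - x.1)
  have hlev : (blkOf i.D.toDomains x).1.1 = i.D.toDomains.lev x.1 := rfl
  rw [hlev]
  refine h2.trans (h1.trans ?_)
  push_cast
  exact le_rfl

end Norms

/-! ## §4 The charted one-level comparison pair `(A^c, G^c, V^c)` of a level `j` and its kernel identities -/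

section Pair

variable (hN : ∀ μ, N0 ℓ Mh k P' μ = (PV d ℓ m K hd hL).sitesPerDir 0)

/-- **`G^c = ε^{−2}·G^ε_j` READ THROUGH THE CHART** (lattice units): the one-level Green's function of Bałaban's scalar torus tower
at level `j` (`(tower P a m²).G j = (−Δ^ε + m² + a_j(L^jε)^{−2}Q*_jQ_j)^{−1}`, [B5]'s `G′_j = G_j^{resc}` up to `(L^jε)²`) as a
matrix on p21's fundamental box. [cite: Balaban1982Higgs1, (2.20) p.610; Balaban1984PropagatorsI, (1.135) p.39 (G′_j), dictionary] -/
def towerPairGc (a msq : ℝ) (j : ℕ) : Matrix ↥(boxDom (N0 ℓ Mh k P')) ↥(boxDom (N0 ℓ Mh k P')) ℝ :=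
  ((PV d ℓ m K hd hL).eps ^ 2)⁻¹ • Matrix.reindex (boxEquiv hN) (boxEquiv hN) ((tower (PV d ℓ m K hd hL) a msq).G j)

/-- **`A^c = ε²·(−Δ^ε + m² + a_j(L^jε)^{−2}Q*_jQ_j)` READ THROUGH THE CHART** (lattice units: `−Δ^{per} + ε²m² + a_jL^{−2j}Q*Q`).
[cite: Balaban1982Higgs1, (2.20) p.610; Balaban1984PropagatorsII, (2.13)–(2.14) p.225, dictionary] -/
def towerPairAc (a msq : ℝ) (j : ℕ) : Matrix ↥(boxDom (N0 ℓ Mh k P')) ↥(boxDom (N0 ℓ Mh k P')) ℝ :=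
  (PV d ℓ m K hd hL).eps ^ 2 • Matrix.reindex (boxEquiv hN) (boxEquiv hN)
    (H (PV d ℓ m K hd hL) msq + α (PV d ℓ m K hd hL) a j • (Qks (PV d ℓ m K hd hL) j * Qk (PV d ℓ m K hd hL) j))

/-- **`V^c = a_jL^{−2j}·Q*_jQ_j` READ THROUGH THE CHART** (the averaging term of `A^c` in lattice units; coefficient `ε²·α_j`).
[cite: Balaban1982Higgs1, (2.11) p.609, (2.20) p.610, dictionary] -/
def towerPairVc (a : ℝ) (j : ℕ) : Matrix ↥(boxDom (N0 ℓ Mh k P')) ↥(boxDom (N0 ℓ Mh k P')) ℝ :=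
  ((PV d ℓ m K hd hL).eps ^ 2 * α (PV d ℓ m K hd hL) a j) •
    Matrix.reindex (boxEquiv hN) (boxEquiv hN) (Qks (PV d ℓ m K hd hL) j * Qk (PV d ℓ m K hd hL) j)

/-- the coefficient of `V^c`: `ε²·α_j = a_j·(L^j)^{−2}` (`α_j = a_j(L^jε)^{−2}`). [cite: Balaban1982Higgs1, (2.20) p.610, bookkeeping] -/
theorem eps_sq_mul_alpha (a : ℝ) (j : ℕ) :
    (PV d ℓ m K hd hL).eps ^ 2 * α (PV d ℓ m K hd hL) a j = B1.aSeq a ((ℓ : ℝ) + 1) j * ((((ℓ : ℝ) + 1) ^ j) ^ 2)⁻¹ := by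
  have hε : (PV d ℓ m K hd hL).eps ≠ 0 := (PV d ℓ m K hd hL).eps_pos.ne'
  have hLr : ((PV d ℓ m K hd hL).L : ℝ) = (ℓ : ℝ) + 1 := by push_cast [PV]; ring
  unfold α Params.spacing
  rw [hLr]
  have hLj : ((ℓ : ℝ) + 1) ^ j ≠ 0 := pow_ne_zero _ (by positivity)
  field_simp

/-- **`A^c = −Δ^{per} + V^c` at `m² = 0`**: the charted one-level operator IS p21's periodic Laplacian plus the charted averaging term
(`reindex_hOp`). [cite: Balaban1984PropagatorsII, (2.13)–(2.14) p.225 («Δ′_a = Δ + Q′*aQ′»); Balaban1982Higgs1, (2.20) p.610, dictionary] -/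
theorem towerPairAc_eq (a : ℝ) (j : ℕ) : towerPairAc hN a 0 j = perLapT (N0 ℓ Mh k P') + towerPairVc hN a j := by
  have hε : (PV d ℓ m K hd hL).eps ≠ 0 := (PV d ℓ m K hd hL).eps_pos.ne'
  unfold towerPairAc towerPairVc H
  rw [← Matrix.coe_reindexLinearEquiv ℝ ℝ, map_add, map_smul]
  simp only [Matrix.coe_reindexLinearEquiv]
  rw [reindex_hOp hN, zero_smul, zero_add, smul_add, smul_smul, smul_smul,
    show (PV d ℓ m K hd hL).eps ^ 2 * ((PV d ℓ m K hd hL).eps⁻¹ * (PV d ℓ m K hd hL).eps⁻¹) = 1 by field_simp, one_smul]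

/-- **`G^cA^c = 1`** (`a > 0`, `m² ≥ 0`, `1 ≤ j`: `G^ε_j` is the inverse of an invertible operator, `B1RG242Torus.G_arg`).
[cite: Balaban1982Higgs1, (2.20) p.610 («G^ε_j exists»), dictionary] -/
theorem towerPairGc_mul_towerPairAc {a msq : ℝ} (ha : 0 < a) (hm : 0 ≤ msq) {j : ℕ} (hj : 1 ≤ j) :
    towerPairGc hN a msq j * towerPairAc hN a msq j = 1 := by
  have hε : (PV d ℓ m K hd hL).eps ^ 2 ≠ 0 := pow_ne_zero 2 (PV d ℓ m K hd hL).eps_pos.ne'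
  have hA := B1RG242Torus.G_arg (PV d ℓ m K hd hL) ha hm j hj
  have hGA : (tower (PV d ℓ m K hd hL) a msq).G j *
      (H (PV d ℓ m K hd hL) msq + α (PV d ℓ m K hd hL) a j • (Qks (PV d ℓ m K hd hL) j * Qk (PV d ℓ m K hd hL) j)) = 1 := by
    show (H (PV d ℓ m K hd hL) msq + α (PV d ℓ m K hd hL) a j • (Qks (PV d ℓ m K hd hL) j * Qk (PV d ℓ m K hd hL) j))⁻¹ * _ = 1
    exact Matrix.nonsing_inv_mul _ ((Matrix.isUnit_iff_isUnit_det _).mp hA)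
  unfold towerPairGc towerPairAc
  rw [Matrix.smul_mul, Matrix.mul_smul, smul_smul, inv_mul_cancel₀ hε, one_smul, Matrix.reindex_apply, Matrix.reindex_apply,
    Matrix.submatrix_mul_equiv, hGA, Matrix.submatrix_one_equiv]

/-- **`G^c` is symmetric** (`G^ε_j = (L^jε)²G_j^{resc}`, `B4Ineq115Torus.Grs_isSymm`). [cite: Balaban1984PropagatorsI, p.33 («G is a symmetric operator»), dictionary] -/
theorem towerPairGc_isSymm {a msq : ℝ} (ha : 0 < a) (hm : 0 ≤ msq) {j : ℕ} (hj : 1 ≤ j) : (towerPairGc hN a msq j).IsSymm := by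
  unfold towerPairGc
  rw [B5Display136Torus.G_eq_smul_Grs ha hm hj, Matrix.reindex_apply]
  exact (((B4Ineq115Torus.Grs_isSymm (P := PV d ℓ m K hd hL) a msq j).smul _).submatrix _).smul _

/-- **`V^c` IS AN `ℓ¹`-CONTRACTION OF SIZE `a_jL^{−2j} ≤ aL^{−2j}`** on the whole torus (`1 ≤ j ≤ m + K`, `a > 0`).
[cite: Balaban1982Higgs1, (2.11) p.609, (2.15) p.609 (a_j ≤ a), bookkeeping] -/
theorem l1_towerPairVc_le {a : ℝ} (ha : 0 < a) {j : ℕ} (hj : 1 ≤ j) (hjK : j ≤ m + K) (u : ↥(boxDom (N0 ℓ Mh k P')) → ℝ) :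
    ∑ y, |(towerPairVc hN a j *ᵥ u) y| ≤ a * ((((ℓ : ℝ) + 1) ^ j) ^ 2)⁻¹ * ∑ y, |u y| := by
  have hL1 : (1 : ℝ) < (ℓ : ℝ) + 1 := by
    have := (PV d ℓ m K hd hL).one_lt_sitesPerDir 0
    have h2 : (1 : ℝ) < ((PV d ℓ m K hd hL).L : ℝ) := by exact_mod_cast (PV d ℓ m K hd hL).hL.2
    push_cast [PV] at h2; linarith
  have hc0 : 0 ≤ B1.aSeq a ((ℓ : ℝ) + 1) j * ((((ℓ : ℝ) + 1) ^ j) ^ 2)⁻¹ :=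
    mul_nonneg (B1.aSeq_pos ha hL1 hj).le (by positivity)
  unfold towerPairVc
  rw [eps_sq_mul_alpha]
  calc ∑ y, |(((B1.aSeq a ((ℓ : ℝ) + 1) j * ((((ℓ : ℝ) + 1) ^ j) ^ 2)⁻¹) •
          Matrix.reindex (boxEquiv hN) (boxEquiv hN) (Qks (PV d ℓ m K hd hL) j * Qk (PV d ℓ m K hd hL) j)) *ᵥ u) y|
      = B1.aSeq a ((ℓ : ℝ) + 1) j * ((((ℓ : ℝ) + 1) ^ j) ^ 2)⁻¹ *
          ∑ y, |(Matrix.reindex (boxEquiv hN) (boxEquiv hN) (Qks (PV d ℓ m K hd hL) j * Qk (PV d ℓ m K hd hL) j) *ᵥ u) y| := by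
        rw [Finset.mul_sum]
        refine Finset.sum_congr rfl fun y _ => ?_
        rw [Matrix.smul_mulVec, Pi.smul_apply, smul_eq_mul, abs_mul, abs_of_nonneg hc0]
    _ ≤ B1.aSeq a ((ℓ : ℝ) + 1) j * ((((ℓ : ℝ) + 1) ^ j) ^ 2)⁻¹ * (1 * ∑ y, |u y|) := by
        refine mul_le_mul_of_nonneg_left ?_ hc0
        exact l1_reindex_le hN _ (fun v => by rw [one_mul]; exact l1_QksQk_le _ hjK v) u
    _ ≤ a * ((((ℓ : ℝ) + 1) ^ j) ^ 2)⁻¹ * ∑ y, |u y| := by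
        rw [one_mul]
        refine mul_le_mul_of_nonneg_right (mul_le_mul_of_nonneg_right (B1.aSeq_le ha hL1 j hj) (by positivity)) ?_
        exact Finset.sum_nonneg fun y _ => abs_nonneg _

/-- ★ **THE SECOND-ORDER KERNEL UNDER THE CHART**: `(∂_μG′_j∂*_νg)(x)` of the tower files (`B5Display136Torus.E`) at `g = f ∘ e`
IS `(dT_μ G^c dT_νᵀ f)(e x)` on p21's box — the scale factors `ε^{−1}·ε²·ε^{−1}` cancel.
[cite: Balaban1984PropagatorsI, (1.112) p.36, (1.136) pp.39–40, dictionary] -/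
theorem E_comp_eq (a msq : ℝ) (j : ℕ) (μ ν : Fin (d + 1)) (f : ↥(boxDom (N0 ℓ Mh k P')) → ℝ)
    (x : Site (PV d ℓ m K hd hL) 0) :
    B5Display136Torus.E (PV d ℓ m K hd hL) a msq j μ ν (f ∘ boxEquiv hN) x
      = ((dT (N0 ℓ Mh k P') μ * towerPairGc hN a msq j * (dT (N0 ℓ Mh k P') ν)ᵀ) *ᵥ f) (boxEquiv hN x) := by
  have hε : (PV d ℓ m K hd hL).eps ≠ 0 := (PV d ℓ m K hd hL).eps_pos.ne'
  unfold B5Display136Torus.E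
  rw [← reindex_mulVec_apply hN]
  congr 2
  have hG : Matrix.reindex (boxEquiv hN) (boxEquiv hN) ((tower (PV d ℓ m K hd hL) a msq).G j)
      = (PV d ℓ m K hd hL).eps ^ 2 • towerPairGc hN a msq j := by
    unfold towerPairGc; rw [smul_smul, mul_inv_cancel₀ (pow_ne_zero 2 hε), one_smul]
  rw [Matrix.reindex_apply, ← Matrix.submatrix_mul_equiv _ _ _ (boxEquiv hN).symm _,
    ← Matrix.submatrix_mul_equiv _ _ _ (boxEquiv hN).symm _, ← Matrix.transpose_submatrix, ← Matrix.reindex_apply,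
    ← Matrix.reindex_apply, ← Matrix.reindex_apply, reindex_deriv hN, reindex_deriv hN, hG, Matrix.transpose_smul]
  simp only [Matrix.smul_mul, Matrix.mul_smul, smul_smul]
  have hs : ∀ s : ℝ, s = 1 → s • (dT (N0 ℓ Mh k P') μ * towerPairGc hN a msq j * (dT (N0 ℓ Mh k P') ν)ᵀ)
      = dT (N0 ℓ Mh k P') μ * towerPairGc hN a msq j * (dT (N0 ℓ Mh k P') ν)ᵀ := by
    rintro s rfl; exact one_smul _ _
  exact hs _ (by field_simp)

/-- ★ **THE FIRST-ORDER KERNEL UNDER THE CHART**: `(G′_j∂*_νg)(x)` of the tower files (`B5Display135Torus.E1`, η-units) at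
`g = f ∘ e` IS `L^{−j}·(G^c dT_νᵀ f)(e x)` on p21's box. [cite: Balaban1984PropagatorsI, (1.110) p.35, (1.135) p.39, dictionary] -/
theorem E1_comp_eq (a msq : ℝ) (j : ℕ) (ν : Fin (d + 1)) (f : ↥(boxDom (N0 ℓ Mh k P')) → ℝ) (x : Site (PV d ℓ m K hd hL) 0) :
    B5Display135Torus.E1 (PV d ℓ m K hd hL) a msq j ν (f ∘ boxEquiv hN) x
      = (((ℓ : ℝ) + 1) ^ j)⁻¹ * ((towerPairGc hN a msq j * (dT (N0 ℓ Mh k P') ν)ᵀ) *ᵥ f) (boxEquiv hN x) := by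
  have hε : (PV d ℓ m K hd hL).eps ≠ 0 := (PV d ℓ m K hd hL).eps_pos.ne'
  have hLr : ((PV d ℓ m K hd hL).L : ℝ) = (ℓ : ℝ) + 1 := by push_cast [PV]; ring
  unfold B5Display135Torus.E1
  have hM : ((tower (PV d ℓ m K hd hL) a msq).G j * (B1RG242Torus.deriv (PV d ℓ m K hd hL) 0 (PV d ℓ m K hd hL).eps ν)ᵀ) *ᵥ
      (f ∘ boxEquiv hN) = fun x => (((PV d ℓ m K hd hL).eps • (towerPairGc hN a msq j * (dT (N0 ℓ Mh k P') ν)ᵀ)) *ᵥ f)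
        (boxEquiv hN x) := by
    funext y
    rw [← reindex_mulVec_apply hN]
    congr 2
    have hG : Matrix.reindex (boxEquiv hN) (boxEquiv hN) ((tower (PV d ℓ m K hd hL) a msq).G j)
        = (PV d ℓ m K hd hL).eps ^ 2 • towerPairGc hN a msq j := by
      unfold towerPairGc; rw [smul_smul, mul_inv_cancel₀ (pow_ne_zero 2 hε), one_smul]
    rw [Matrix.reindex_apply, ← Matrix.submatrix_mul_equiv _ _ _ (boxEquiv hN).symm _, ← Matrix.transpose_submatrix,
      ← Matrix.reindex_apply, ← Matrix.reindex_apply, reindex_deriv hN, hG, Matrix.transpose_smul, Matrix.smul_mul,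
      Matrix.mul_smul, smul_smul, pow_two, mul_assoc, mul_inv_cancel₀ hε, mul_one]
  rw [hM]
  dsimp only
  rw [Matrix.smul_mulVec, Pi.smul_apply, smul_eq_mul, ← mul_assoc]
  congr 1
  unfold Params.spacing
  rw [hLr]
  have hLj : ((ℓ : ℝ) + 1) ^ j ≠ 0 := pow_ne_zero _ (by positivity)
  field_simp

omit hN in
/-- **the transposed outer difference is a translate of the plain one**: `(dT_κᵀ v)(y) = −(dT_κ v)(y − e_κ)` ([B5] p. 36: «the
choice of derivatives … is accidental»). [cite: Balaban1984PropagatorsI, p.36 (remark after (1.114)), dictionary] -/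
theorem dT_transpose_mulVec (N : Fin (d + 1) → ℕ) (κ : Fin (d + 1)) (v : ↥(boxDom N) → ℝ) (y : ↥(boxDom N)) :
    ((dT N κ)ᵀ *ᵥ v) y = -((dT N κ *ᵥ v) (tshift N (-unitVec κ) y)) := by
  rw [dT_mulVec, tshift_tshift, neg_add_cancel, tshift_zero]
  unfold dT
  rw [Matrix.transpose_sub, Matrix.transpose_one, ← shiftMat_neg, Matrix.sub_mulVec, Matrix.one_mulVec, Pi.sub_apply,
    B6MultiLevelTorusOperator.shiftMat_mulVec]
  ring

end Pair

end Literature.MathematicalPhysics.QuantumFieldTheory.Balaban1983to89.B9Ineq344TowerChart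

end
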